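import Literature.Computability.Complexity.RossmanMonotoneCliqueGraphs
import Literature.Computability.Complexity.GnpSprinkling
import HarnessLib

/-!
# Planted likelihood ratios under `G(n,q)`: the second-moment method for planted patterns

Tools for showing that planting a fixed small pattern at a random position into the binomial
random graph `G(n,q)` is invisible to (monotone) tests, in the finite-sum vocabulary of
`Rossman2008.lean` / `RossmanMonotoneClique.lean` (`gnpWeight n q x`, `edgeCount`, edge vectors
`x : E(K_n) → Bool`, union of graphs = the join `x ⊔ t`). This is the second-moment /
Cauchy–Schwarz template behind Lemma 23 of

* B. Rossman, *The monotone complexity of k-clique on random graphs*, FOCS 2010 / SIAM J. Comput.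
  43 (2014) [Rossman2010], Appendix B,

written for the planted family "`k`-clique minus an edge" of route PneNP/OneSlice (crux
`SingleThreshold`, line `two-round-exposure`), but independent of it. Everything is PROVED; there
are no definitions and no named facts.

* Weighted-sum algebra over a probability vector `w`: centering
  (`sum_mul_centered_mul_centered`), expansion of `E[(Σ_p (L_p - 1))²]` (`sum_mul_sq_sum_eq`),
  Cauchy–Schwarz `E[|D|]² ≤ E[D²]` (`sq_sum_mul_abs_le`), `|E[[c] D]| ≤ E[|D|]`, and the exchange
  of sums behind an averaged advantage (`sum_mul_sum_sub_eq`).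
* Likelihood ratios `L_t(x) = q^{-e(t)} [t ⊆ x]` of a planted edge set `t`: the planting identity
  `E[G(x ∪ t)] = E[L_t(x) G(x)]` (`sum_gnpWeight_mul_sup_eq_sum_lr`, a rewriting of
  `sum_filter_forall_gnpWeight_mul`), `E[L_t] = 1`, `Pr[t ⊆ x] = q^{e(t)}`,
  `E[L_t L_s] = q^{-e(t ∩ s)}` and `E[(L_t-1)(L_s-1)] = q^{-e(t ∩ s)} - 1`.
* `sq_sum_adv_le`: for a finite planted family `(Q_p)_{p ∈ P}` and a `0/1` test `[c]`,
  `E[[c] · Σ_p (L_{Q_p} - 1)]² ≤ Σ_{p,p'} (q^{-e(Q_p ∩ Q_{p'})} - 1)`.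
* The family of pairs `(A, e)`, `A` a `k`-set and `e` an edge of `K_A` (`mem_pairs_iff`,
  `sum_pairs_eq`), and the exponent bookkeeping at Rossman's subcritical density
  `q = pMinus k ε n = n^{-2(1+ε)/(k-1)}` with `ε ≤ k⁻³` (`rpow_overlap_le`): every proper
  subpattern of `K_k` (overlap `j` vertices, `2 ≤ j < k`) and `K_k` minus an edge are strictly
  supercritical, `n^{-j} q^{-min(C(j,2), C(k,2)-1)} ≤ n^{-1/(k-1)}`.

## References

* [Rossman2010] B. Rossman, The monotone complexity of k-clique on random graphs, FOCS 2010,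
  193–201; SIAM J. Comput. 43 (2014) 256–279 — Appendix B, Lemma 23 (pp. 13–14).
* S. Janson, T. Łuczak, A. Ruciński, Random Graphs (2000), §3 (contiguity of planted
  supercritical patterns is folklore).
-/

noncomputable section

namespace Literature.Computability.Complexity

open Finset Filter

open scoped Classical

variable {n : ℕ}

/-! ### Weighted-sum algebra (second moment, Cauchy–Schwarz) -/

section Algebra

variable {X π : Type*} [Fintype X]

/-- Centering: if `E[L] = E[L'] = 1` then `E[(L-1)(L'-1)] = E[L L'] - 1`. [folklore] -/
theorem sum_mul_centered_mul_centered (w L L' : X → ℝ) (hw : ∑ x, w x = 1)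
    (hL : ∑ x, w x * L x = 1) (hL' : ∑ x, w x * L' x = 1) :
    ∑ x, w x * ((L x - 1) * (L' x - 1)) = ∑ x, w x * (L x * L' x) - 1 := by
  have : ∀ x, w x * ((L x - 1) * (L' x - 1)) =
      w x * (L x * L' x) - w x * L x - w x * L' x + w x := fun x => by ring
  rw [sum_congr rfl fun x _ => this x, sum_add_distrib, sum_sub_distrib, sum_sub_distrib, hw, hL,
    hL']
  ring

/-- Expanding the second moment of a sum: `E[(Σ_p (L_p - 1))²] = Σ_{p,p'} E[(L_p-1)(L_{p'}-1)]`.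
[folklore] -/
theorem sum_mul_sq_sum_eq (P : Finset π) (w : X → ℝ) (L : π → X → ℝ) :
    ∑ x, w x * (∑ p ∈ P, (L p x - 1)) ^ 2 =
      ∑ p ∈ P, ∑ p' ∈ P, ∑ x, w x * ((L p x - 1) * (L p' x - 1)) := by
  have : ∀ x, w x * (∑ p ∈ P, (L p x - 1)) ^ 2 =
      ∑ p ∈ P, ∑ p' ∈ P, w x * ((L p x - 1) * (L p' x - 1)) := fun x => by
    rw [sq, sum_mul_sum, mul_sum]
    exact sum_congr rfl fun p _ => by rw [mul_sum]
  rw [sum_congr rfl fun x _ => this x, sum_comm]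
  exact sum_congr rfl fun p _ => sum_comm

/-- **Cauchy–Schwarz / Jensen** for a probability vector: `E[|D|]² ≤ E[D²]`. [folklore] -/
theorem sq_sum_mul_abs_le (w D : X → ℝ) (hw0 : ∀ x, 0 ≤ w x) (hw : ∑ x, w x = 1) :
    (∑ x, w x * |D x|) ^ 2 ≤ ∑ x, w x * D x ^ 2 := by
  have h := sum_sq_le_sum_mul_sum_of_sq_le_mul (s := (univ : Finset X))
    (r := fun x => w x * |D x|) (f := w) (g := fun x => w x * D x ^ 2) (fun x _ => hw0 x)
    (fun x _ => mul_nonneg (hw0 x) (sq_nonneg _)) (fun x _ => by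
      rw [mul_pow, sq_abs]; exact le_of_eq (by ring))
  simpa [hw] using h

/-- For a `0/1`-valued `F`: `|E[F · D]| ≤ E[|D|]`. [folklore] -/
theorem abs_sum_mul_ite_mul_le (w D : X → ℝ) (hw0 : ∀ x, 0 ≤ w x) (c : X → Prop)
    [DecidablePred c] :
    |∑ x, w x * ((if c x then (1 : ℝ) else 0) * D x)| ≤ ∑ x, w x * |D x| := by
  refine (abs_sum_le_sum_abs _ _).trans (sum_le_sum fun x _ => ?_)
  rw [abs_mul, abs_of_nonneg (hw0 x)]
  refine mul_le_mul_of_nonneg_left ?_ (hw0 x)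
  split_ifs
  · rw [one_mul]
  · rw [zero_mul, abs_zero]; exact abs_nonneg _

/-- Exchange of summations behind the advantage: if `E[G_p] = E[L_p F]` for every `p`, then
`E[Σ_p (G_p - F)] = E[F · Σ_p (L_p - 1)]`. [folklore] -/
theorem sum_mul_sum_sub_eq (P : Finset π) (w F : X → ℝ) (G L : π → X → ℝ)
    (h : ∀ p ∈ P, ∑ x, w x * G p x = ∑ x, w x * (L p x * F x)) :
    ∑ x, w x * ∑ p ∈ P, (G p x - F x) = ∑ x, w x * (F x * ∑ p ∈ P, (L p x - 1)) := by
  calc ∑ x, w x * ∑ p ∈ P, (G p x - F x)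
      = ∑ p ∈ P, ∑ x, (w x * G p x - w x * F x) := by
        simp_rw [mul_sum, mul_sub]
        exact sum_comm
    _ = ∑ p ∈ P, ∑ x, (w x * (L p x * F x) - w x * F x) := sum_congr rfl fun p hp => by
        rw [sum_sub_distrib, sum_sub_distrib, h p hp]
    _ = ∑ x, w x * (F x * ∑ p ∈ P, (L p x - 1)) := by
        rw [sum_comm]
        refine sum_congr rfl fun x _ => ?_
        rw [mul_sum, mul_sum]
        exact sum_congr rfl fun p _ => by ring

end Algebra

/-! ### Likelihood ratios of planted edge sets under `G(n,q)` -/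

/-- The pointwise order of Boolean vectors is edgewise implication. [folklore] -/
theorem le_iff_forall_imp {ι : Type*} (t x : ι → Bool) : t ≤ x ↔ ∀ e, t e = true → x e = true := by
  simp only [Pi.le_def, Bool.le_iff_imp]

/-- **Planting identity in likelihood-ratio form.** For `q ≠ 0`, an edge vector `t` and any
real-valued `G`: `E[G(x ∪ t)] = E[L_t(x) G(x)]` for `x ∼ G(n,q)`, with the likelihood ratio
`L_t(x) = q^{-e(t)} [t ⊆ x]` of the planted law against `G(n,q)` (independence of disjoint edge
sets, `sum_filter_forall_gnpWeight_mul`). [cite: Rossman2010, App. B (proof of Lemma 23, p. 14)] -/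
theorem sum_gnpWeight_mul_sup_eq_sum_lr {q : ℝ} (hq : q ≠ 0)
    (t : (⊤ : SimpleGraph (Fin n)).edgeSet → Bool)
    (G : ((⊤ : SimpleGraph (Fin n)).edgeSet → Bool) → ℝ) :
    ∑ x, gnpWeight n q x * G (x ⊔ t) =
      ∑ x, gnpWeight n q x * (((q ^ edgeCount t)⁻¹ * if t ≤ x then 1 else 0) * G x) := by
  have h := sum_filter_forall_gnpWeight_mul q t G
  have hpow : q ^ edgeCount t ≠ 0 := pow_ne_zero _ hq
  calc ∑ x, gnpWeight n q x * G (x ⊔ t)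
      = (q ^ edgeCount t)⁻¹ *
          ∑ x ∈ univ.filter (fun x : (⊤ : SimpleGraph (Fin n)).edgeSet → Bool =>
              ∀ e, t e = true → x e = true), gnpWeight n q x * G x := by
        rw [h, ← mul_assoc, inv_mul_cancel₀ hpow, one_mul]
    _ = ∑ x, gnpWeight n q x * (((q ^ edgeCount t)⁻¹ * if t ≤ x then 1 else 0) * G x) := by
        rw [sum_filter, mul_sum]
        refine sum_congr rfl fun x _ => ?_
        by_cases hx : t ≤ x
        · rw [if_pos ((le_iff_forall_imp t x).1 hx), if_pos hx]; ring
        · rw [if_neg (fun h' => hx ((le_iff_forall_imp t x).2 h')), if_neg hx]; ring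

/-- The likelihood ratio has mean one: `E[L_t] = 1`. [folklore] -/
theorem sum_gnpWeight_mul_lr {q : ℝ} (hq : q ≠ 0)
    (t : (⊤ : SimpleGraph (Fin n)).edgeSet → Bool) :
    ∑ x, gnpWeight n q x * ((q ^ edgeCount t)⁻¹ * if t ≤ x then 1 else 0) = 1 := by
  have h := sum_gnpWeight_mul_sup_eq_sum_lr hq t (fun _ => 1)
  simp only [mul_one] at h
  rw [← h, sum_gnpWeight]

/-- `e(t ∪ s) + e(t ∩ s) = e(t) + e(s)`. [folklore] -/
theorem edgeCount_sup_add_edgeCount_inf (t s : (⊤ : SimpleGraph (Fin n)).edgeSet → Bool) :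
    edgeCount (t ⊔ s) + edgeCount (t ⊓ s) = edgeCount t + edgeCount s := by
  change #(onSet (t ⊔ s)) + #(onSet (t ⊓ s)) = #(onSet t) + #(onSet s)
  rw [onSet_sup, onSet_inf, card_union_add_card_inter]

/-- `Pr[t ⊆ G(n,q)] = q^{e(t)}`. [folklore] -/
theorem sum_gnpWeight_mul_ite_le (q : ℝ) (t : (⊤ : SimpleGraph (Fin n)).edgeSet → Bool) :
    ∑ x, gnpWeight n q x * (if t ≤ x then (1 : ℝ) else 0) = q ^ edgeCount t := by
  have h := sum_filter_forall_gnpWeight_mul q t (fun _ => (1 : ℝ))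
  simp only [mul_one] at h
  rw [sum_gnpWeight, mul_one, sum_filter] at h
  rw [← h]
  refine sum_congr rfl fun x _ => ?_
  rw [le_iff_forall_imp]
  split_ifs <;> simp

/-- **Second moment of two planted likelihood ratios**: `E[L_t L_s] = q^{-e(t ∩ s)}` (`q ≠ 0`):
`L_t L_s = q^{-e(t)-e(s)} [t ∪ s ⊆ x]`, `Pr[t ∪ s ⊆ x] = q^{e(t ∪ s)}` and
`e(t ∪ s) + e(t ∩ s) = e(t) + e(s)`. [folklore] -/
theorem sum_gnpWeight_mul_lr_mul_lr {q : ℝ} (hq : q ≠ 0)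
    (t s : (⊤ : SimpleGraph (Fin n)).edgeSet → Bool) :
    ∑ x, gnpWeight n q x * (((q ^ edgeCount t)⁻¹ * if t ≤ x then 1 else 0) *
        ((q ^ edgeCount s)⁻¹ * if s ≤ x then 1 else 0)) = (q ^ edgeCount (t ⊓ s))⁻¹ := by
  have h2 : ∀ x : (⊤ : SimpleGraph (Fin n)).edgeSet → Bool,
      ((if t ≤ x then (1 : ℝ) else 0) * if s ≤ x then 1 else 0) = if t ⊔ s ≤ x then 1 else 0 := by
    intro x
    by_cases ht : t ≤ x <;> by_cases hs : s ≤ x <;> simp [ht, hs, sup_le_iff]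
  have hcount : q ^ edgeCount t * q ^ edgeCount s =
      q ^ edgeCount (t ⊔ s) * q ^ edgeCount (t ⊓ s) := by
    rw [← pow_add, ← pow_add, edgeCount_sup_add_edgeCount_inf]
  calc ∑ x, gnpWeight n q x * (((q ^ edgeCount t)⁻¹ * if t ≤ x then 1 else 0) *
        ((q ^ edgeCount s)⁻¹ * if s ≤ x then 1 else 0))
      = (q ^ edgeCount t)⁻¹ * (q ^ edgeCount s)⁻¹ *
          ∑ x, gnpWeight n q x * (if t ⊔ s ≤ x then (1 : ℝ) else 0) := by
        rw [mul_sum]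
        refine sum_congr rfl fun x _ => ?_
        rw [← h2 x]; ring
    _ = (q ^ edgeCount (t ⊓ s))⁻¹ := by
        rw [sum_gnpWeight_mul_ite_le, ← mul_inv, hcount, mul_inv, mul_comm, ← mul_assoc,
          mul_inv_cancel₀ (pow_ne_zero _ hq), one_mul]

/-- Centered second moment: `E[(L_t - 1)(L_s - 1)] = q^{-e(t ∩ s)} - 1`. [folklore] -/
theorem sum_gnpWeight_mul_lrc_mul_lrc {q : ℝ} (hq : q ≠ 0)
    (t s : (⊤ : SimpleGraph (Fin n)).edgeSet → Bool) :
    ∑ x, gnpWeight n q x * ((((q ^ edgeCount t)⁻¹ * if t ≤ x then 1 else 0) - 1) *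
        (((q ^ edgeCount s)⁻¹ * if s ≤ x then 1 else 0) - 1)) =
      (q ^ edgeCount (t ⊓ s))⁻¹ - 1 := by
  rw [sum_mul_centered_mul_centered _ _ _ (sum_gnpWeight q) (sum_gnpWeight_mul_lr hq t)
    (sum_gnpWeight_mul_lr hq s), sum_gnpWeight_mul_lr_mul_lr hq t s]


/-- **Squared advantage ≤ second moment.** For a finite planted family `(Q_p)_{p ∈ P}` and a
`0/1`-valued `F = [c]`: `E[F · Σ_p (L_{Q_p} - 1)]² ≤ Σ_{p,p'} (q^{-e(Q_p ∩ Q_{p'})} - 1)`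
(Cauchy–Schwarz and the second moments of the likelihood ratios). [folklore] -/
theorem sq_sum_adv_le {π : Type*} (P : Finset π)
    (Qf : π → (⊤ : SimpleGraph (Fin n)).edgeSet → Bool) {q : ℝ} (hq0 : 0 < q) (hq1 : q ≤ 1)
    (c : ((⊤ : SimpleGraph (Fin n)).edgeSet → Bool) → Prop) [DecidablePred c] :
    (∑ x, gnpWeight n q x * ((if c x then (1 : ℝ) else 0) *
        ∑ p ∈ P, (((q ^ edgeCount (Qf p))⁻¹ * if Qf p ≤ x then 1 else 0) - 1))) ^ 2 ≤
      ∑ p ∈ P, ∑ p' ∈ P, ((q ^ edgeCount (Qf p ⊓ Qf p'))⁻¹ - 1) := by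
  have hw0 : ∀ x, 0 ≤ gnpWeight n q x := gnpWeight_nonneg hq0.le hq1
  have hw1 := sum_gnpWeight (n := n) q
  have hab := abs_le.1 (abs_sum_mul_ite_mul_le (fun x => gnpWeight n q x)
    (fun x => ∑ p ∈ P, (((q ^ edgeCount (Qf p))⁻¹ * if Qf p ≤ x then 1 else 0) - 1)) hw0 c)
  calc (∑ x, gnpWeight n q x * ((if c x then (1 : ℝ) else 0) *
        ∑ p ∈ P, (((q ^ edgeCount (Qf p))⁻¹ * if Qf p ≤ x then 1 else 0) - 1))) ^ 2
      ≤ (∑ x, gnpWeight n q x *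
          |∑ p ∈ P, (((q ^ edgeCount (Qf p))⁻¹ * if Qf p ≤ x then 1 else 0) - 1)|) ^ 2 :=
        sq_le_sq' hab.1 hab.2
    _ ≤ ∑ x, gnpWeight n q x *
          (∑ p ∈ P, (((q ^ edgeCount (Qf p))⁻¹ * if Qf p ≤ x then 1 else 0) - 1)) ^ 2 :=
        sq_sum_mul_abs_le _ _ hw0 hw1
    _ = ∑ p ∈ P, ∑ p' ∈ P, ∑ x, gnpWeight n q x *
          ((((q ^ edgeCount (Qf p))⁻¹ * if Qf p ≤ x then 1 else 0) - 1) *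
            (((q ^ edgeCount (Qf p'))⁻¹ * if Qf p' ≤ x then 1 else 0) - 1)) :=
        sum_mul_sq_sum_eq P _ (fun p x => (q ^ edgeCount (Qf p))⁻¹ * if Qf p ≤ x then 1 else 0)
    _ = ∑ p ∈ P, ∑ p' ∈ P, ((q ^ edgeCount (Qf p ⊓ Qf p'))⁻¹ - 1) :=
        sum_congr rfl fun p _ => sum_congr rfl fun p' _ =>
          sum_gnpWeight_mul_lrc_mul_lrc hq0.ne' (Qf p) (Qf p')

/-! ### The family of pairs `(A, e)`, `e` an edge of `K_A` -/

/-- Membership in the family of pairs `(A, e)`, `A` a `k`-set, `e` an edge of `K_A`. [folklore] -/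
theorem mem_pairs_iff {k : ℕ} (p : Finset (Fin n) × (⊤ : SimpleGraph (Fin n)).edgeSet) :
    p ∈ ((powersetCard k (univ : Finset (Fin n))) ×ˢ
        (univ : Finset ((⊤ : SimpleGraph (Fin n)).edgeSet))).filter
          (fun p => cliqueVec p.1 p.2 = true) ↔
      p.1 ∈ powersetCard k (univ : Finset (Fin n)) ∧
        p.2 ∈ univ.filter (fun e : (⊤ : SimpleGraph (Fin n)).edgeSet =>
          cliqueVec p.1 e = true) := by
  simp only [mem_filter, mem_product, mem_univ, true_and, and_true]

/-- Summing a function of the `k`-set over the pairs `(A, e ∈ K_A)` counts it `C(k,2)` times.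
[folklore] -/
theorem sum_pairs_eq {k : ℕ} (g : Finset (Fin n) → ℝ) :
    ∑ p ∈ ((powersetCard k (univ : Finset (Fin n))) ×ˢ
        (univ : Finset ((⊤ : SimpleGraph (Fin n)).edgeSet))).filter
          (fun p => cliqueVec p.1 p.2 = true), g p.1 =
      (k.choose 2 : ℝ) * ∑ A ∈ powersetCard k (univ : Finset (Fin n)), g A := by
  rw [sum_finset_product' (((powersetCard k (univ : Finset (Fin n))) ×ˢ
      (univ : Finset ((⊤ : SimpleGraph (Fin n)).edgeSet))).filter
        (fun p => cliqueVec p.1 p.2 = true)) (powersetCard k (univ : Finset (Fin n)))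
      (fun A => univ.filter fun e : (⊤ : SimpleGraph (Fin n)).edgeSet => cliqueVec A e = true)
      mem_pairs_iff (f := fun A _ => g A), mul_sum]
  refine sum_congr rfl fun A hA => ?_
  rw [sum_const, card_filter_cliqueVec, (mem_powersetCard.1 hA).2, nsmul_eq_mul]

/-! ### Every proper subpattern of `K_k` is strictly supercritical at `pMinus` -/

/-- **Exponent bookkeeping.** For `k ≥ 5`, `0 < ε ≤ k⁻³`, `q = pMinus k ε n = n^{-2(1+ε)/(k-1)}`,
`n ≥ 1` and `j ≤ k`: `n^{-j} (q^{-min(C(j,2), C(k,2)-1)} - 1) ≤ n^{-1/(k-1)}`. For `j ≤ 1` the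
left side vanishes; for `2 ≤ j ≤ k-1` the exponent is
`-j + (1+ε) j(j-1)/(k-1) ≤ -j(1 - ε(k-2))/(k-1)·… ≤ -1/(k-1)`; for `j = k` it is
`εk - 2(1+ε)/(k-1) ≤ -1/(k-1)`. [folklore] -/
theorem rpow_overlap_le {k : ℕ} (hk : 5 ≤ k) {ε : ℝ} (hε : 0 < ε) (hεk : ε ≤ 1 / (k : ℝ) ^ 3)
    (hn : 1 ≤ n) {j : ℕ} (hj : j ≤ k) :
    ((n : ℝ) ^ j)⁻¹ * ((pMinus k ε n ^ min (j.choose 2) (k.choose 2 - 1))⁻¹ - 1) ≤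
      (n : ℝ) ^ (-(1 / ((k : ℝ) - 1))) := by
  have hK : (5 : ℝ) ≤ k := by exact_mod_cast hk
  have hK1 : (0 : ℝ) < (k : ℝ) - 1 := by linarith
  have hn0 : (0 : ℝ) < n := by exact_mod_cast hn
  have hn1 : (1 : ℝ) ≤ n := by exact_mod_cast hn
  -- `ε`-arithmetic
  have hεK3 : ε * (k : ℝ) ^ 3 ≤ 1 := by rwa [le_div_iff₀ (by positivity)] at hεk
  have hεK1 : ε * (k : ℝ) ≤ 1 / 25 := by
    have h25 : (25 : ℝ) ≤ (k : ℝ) ^ 2 := by nlinarith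
    have h0 : 0 ≤ ε * (k : ℝ) := by positivity
    have h1 := mul_le_mul_of_nonneg_left h25 h0
    have h3 : ε * (k : ℝ) * (k : ℝ) ^ 2 = ε * (k : ℝ) ^ 3 := by ring
    linarith
  have hεK2 : ε * (k : ℝ) ^ 2 ≤ 1 / 5 := by
    have h0 : 0 ≤ ε * (k : ℝ) ^ 2 := by positivity
    have h1 := mul_le_mul_of_nonneg_left hK h0
    have h3 : ε * (k : ℝ) ^ 2 * (k : ℝ) = ε * (k : ℝ) ^ 3 := by ring
    linarith
  -- the density as a power of `n`
  set β : ℝ := 2 * (1 + ε) / ((k : ℝ) - 1) with hβ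
  have hβ0 : 0 < β := by positivity
  have hq : pMinus k ε n = (n : ℝ) ^ (-β) := by simp only [pMinus, hβ, neg_div]
  set M : ℕ := min (j.choose 2) (k.choose 2 - 1) with hM
  have hqM : (pMinus k ε n ^ M)⁻¹ = (n : ℝ) ^ (β * M) := by
    rw [hq, ← Real.rpow_mul_natCast hn0.le, neg_mul, Real.rpow_neg hn0.le, inv_inv]
  have hnj : ((n : ℝ) ^ j)⁻¹ = (n : ℝ) ^ (-(j : ℝ)) := by
    rw [Real.rpow_neg hn0.le, Real.rpow_natCast]
  rcases Nat.lt_or_ge j 2 with hj2 | hj2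
  · -- `j ≤ 1`: the term vanishes
    have h0 : M = 0 := by
      show min (j.choose 2) (k.choose 2 - 1) = 0
      rw [Nat.choose_eq_zero_of_lt hj2, Nat.zero_min]
    rw [h0, pow_zero, inv_one, sub_self, mul_zero]
    exact Real.rpow_nonneg hn0.le _
  · -- `2 ≤ j`: compare exponents
    have hdrop : ((n : ℝ) ^ j)⁻¹ * ((pMinus k ε n ^ M)⁻¹ - 1) ≤
        ((n : ℝ) ^ j)⁻¹ * (pMinus k ε n ^ M)⁻¹ :=
      mul_le_mul_of_nonneg_left (by linarith) (by positivity)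
    refine hdrop.trans ?_
    rw [hqM, hnj, ← Real.rpow_add hn0]
    refine Real.rpow_le_rpow_of_exponent_le hn1 ?_
    have hJ2 : (2 : ℝ) ≤ j := by exact_mod_cast hj2
    rcases Nat.lt_or_ge j k with hjk | hkj
    · -- `j < k`: `M ≤ C(j,2)`
      have hMle : (M : ℝ) ≤ (j : ℝ) * ((j : ℝ) - 1) / 2 := by
        rw [← Nat.cast_choose_two]
        exact_mod_cast min_le_left _ _
      have hJk1 : (j : ℝ) ≤ (k : ℝ) - 1 := by
        have : ((j + 1 : ℕ) : ℝ) ≤ k := by exact_mod_cast hjk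
        push_cast at this
        linarith
      have hεJ : ε * ((j : ℝ) - 1) ≤ 1 / 25 :=
        le_trans (mul_le_mul_of_nonneg_left (by linarith) hε.le) hεK1
      have h1 : (1 + ε) * ((j : ℝ) - 1) ≤ (k : ℝ) - 2 + 1 / 25 := by linarith
      have h2 : (j : ℝ) * ((1 + ε) * ((j : ℝ) - 1)) ≤ (j : ℝ) * ((k : ℝ) - 2 + 1 / 25) :=
        mul_le_mul_of_nonneg_left h1 (by linarith)
      have key : (1 + ε) * (j : ℝ) * ((j : ℝ) - 1) + 1 ≤ (j : ℝ) * ((k : ℝ) - 1) := by linarith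
      have hβM : β * (M : ℝ) ≤ β * ((j : ℝ) * ((j : ℝ) - 1) / 2) :=
        mul_le_mul_of_nonneg_left hMle hβ0.le
      have hid : -(j : ℝ) + β * ((j : ℝ) * ((j : ℝ) - 1) / 2) - -(1 / ((k : ℝ) - 1)) =
          ((1 + ε) * (j : ℝ) * ((j : ℝ) - 1) + 1 - (j : ℝ) * ((k : ℝ) - 1)) / ((k : ℝ) - 1) := by
        rw [hβ]
        field_simp
        ring
      have hle : -(j : ℝ) + β * ((j : ℝ) * ((j : ℝ) - 1) / 2) ≤ -(1 / ((k : ℝ) - 1)) := by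
        rw [← sub_nonpos, hid]
        exact div_nonpos_of_nonpos_of_nonneg (by linarith) hK1.le
      linarith
    · -- `j = k`: `M ≤ C(k,2) - 1`
      obtain rfl : k = j := le_antisymm hkj hj
      have hck : 1 ≤ k.choose 2 := Nat.succ_le_of_lt (Nat.choose_pos (by omega))
      have hMle : (M : ℝ) ≤ (k : ℝ) * ((k : ℝ) - 1) / 2 - 1 := by
        have h : M ≤ k.choose 2 - 1 := min_le_right _ _
        have hc : ((k.choose 2 - 1 : ℕ) : ℝ) = (k : ℝ) * ((k : ℝ) - 1) / 2 - 1 := by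
          rw [Nat.cast_sub hck, Nat.cast_choose_two, Nat.cast_one]
        rw [← hc]
        exact_mod_cast h
      have h0 : 0 ≤ ε * (k : ℝ) := by positivity
      have key : ε * (k : ℝ) * ((k : ℝ) - 1) ≤ 1 + 2 * ε := by nlinarith
      have hβM : β * (M : ℝ) ≤ β * ((k : ℝ) * ((k : ℝ) - 1) / 2 - 1) :=
        mul_le_mul_of_nonneg_left hMle hβ0.le
      have hid : -(k : ℝ) + β * ((k : ℝ) * ((k : ℝ) - 1) / 2 - 1) - -(1 / ((k : ℝ) - 1)) =
          (ε * (k : ℝ) * ((k : ℝ) - 1) - 1 - 2 * ε) / ((k : ℝ) - 1) := by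
        rw [hβ]
        field_simp
        ring
      have hle : -(k : ℝ) + β * ((k : ℝ) * ((k : ℝ) - 1) / 2 - 1) ≤ -(1 / ((k : ℝ) - 1)) := by
        rw [← sub_nonpos, hid]
        exact div_nonpos_of_nonpos_of_nonneg (by linarith) hK1.le
      linarith

end Literature.Computability.Complexity

end
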